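import Literature.AnabelianGeometry.EtaleTheta.ChainDivisorCombinatorics

/-!
# [EtTh] §5, proof of Proposition 5.3 (iv)–(vi): the three printed criteria from the intersection theory of the
# chain — PROVED (abstract form)

Mochizuki, *The étale theta function …*, Publ. RIMS **45** (2009), proof of Prop. 5.3, pp.326–327 (PDF
pp.100–101) [cite: MochizukiEtTh2009, Prop 5.3 proof p.326–327 (PDF pp.100–101)].  Proof-only companion of
`ChainDivisorCombinatorics.lean` (same seat): over the dual data of the special fibre (components `ℤ`, cusps `K`,
`π : K → ℤ`) and cuspidal order functions `h : K → ℚ` with their `finsum` degrees `cuspDeg π h i`, we derive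
* `adjacency_criterion` (+ the competitor-relative count `HasDegrees.ncard_support_eq_stencilSupport`) — (v):
  "`𝔭, 𝔮` are adjacent (respectively, not adjacent) if and only if every cuspidally minimal `c` … linearly
  equivalent to `a + b` has support of cardinality 4 (respectively, 5 or 6)";
* `fibre_eq_of_cuspDeg_neg` / `cspToNcsp_criterion` — (iv): "the natural surjection of (iv) is obtained by
  mapping the prime determined by `a` to the prime determined by `n`", and `exists_isDegMinimal_neg_only_at` —
  the configuration exists over every cusp;
* `incidence_structure_of_le` / `incidence_structure` — the p.326 sentence "`n` is linearly equivalent to …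
  `n₁ + n₂ − a` … the multiplicities of `n₁, n₂` are equal to each other as well as to half the multiplicity
  of `a`".
Hypothesis-free; consumers (GAP-LEDGER G-L2d4-2, the repaired `DivisorSupportData'` with its intersection-number
binder) supply the dictionary.  Prop. 5.3 is classical and undisputed; nothing here takes a side on anything
downstream.
-/

namespace Literature.AnabelianGeometry.EtaleTheta.ChainDivisors

open Set Function

variable {K : Type*} {π : K → ℤ}

/-! ### The adjacency criterion of Proposition 5.3 (v) ("4 versus 5 or 6", pp.326–327) -/

/-- The degrees forced on a cuspidal divisor linearly equivalent to `m · (n_p + n_q)`: `c · (stencil p + stencil q)`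
(`c = m`, or `λ m` for a pairing normalised by `n_i · n_{i±1} = λ`); its non-vanishing set is `stencilSupport p q` for `c ≠ 0`.
[cite: MochizukiEtTh2009, Prop 5.3 proof p.326–327 (PDF pp.100–101)] -/
theorem setOf_pairDegrees_ne_zero {p q : ℤ} {c : ℚ} (hc : c ≠ 0) :
    {i | c * ((stencil p i + stencil q i : ℤ) : ℚ) ≠ 0} = stencilSupport p q := by
  ext i
  simp only [mem_setOf_eq, ne_eq, mul_eq_zero, hc, false_or, Int.cast_eq_zero, stencilSupport]

/-- **The "4 / 5 / 6" count for a cuspidal divisor linearly equivalent to `m·(n_p + n_q)`, competitor-relative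
form.**  If `h` has degrees `c · (stencil p + stencil q)` (`c ≠ 0`) and its support is no larger than that of
the one-cusp-per-component competitor `ofSection π s _`, then `|supp h| = |stencilSupport p q|` (`= 4, 5, 6`
by `ncard_stencilSupport_*`).  [cite: MochizukiEtTh2009, Prop 5.3 proof p.326–327 (PDF pp.100–101)] -/
theorem HasDegrees.ncard_support_eq_stencilSupport {p q : ℤ} {c : ℚ} (hc : c ≠ 0) {h : K → ℚ}
    (hh : HasDegrees π (fun i => c * ((stencil p i + stencil q i : ℤ) : ℚ)) h) {s : ℤ → K}
    (hs : ∀ i, π (s i) = i)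
    (hle : (support h).encard ≤
      (support (ofSection π s fun i => c * ((stencil p i + stencil q i : ℤ) : ℚ))).encard) :
    (support h).ncard = (stencilSupport p q).ncard := by
  rw [hh.ncard_support_eq_of_le hs hle, setOf_pairDegrees_ne_zero hc]

/-- **[EtTh] Prop. 5.3 (v), the adjacency criterion (abstract form).**  For distinct components `p ≠ q`, every
component carrying a cusp, and degrees `c · (stencil p + stencil q)` with `c ≠ 0` (the class of `m·(n_p + n_q)`,
`c = m` up to the normalisation of the pairing): `p, q` are adjacent iff every degree-minimal cuspidal divisor of that class has support of cardinality
`4`, and not adjacent iff every such divisor has support of cardinality `5` or `6` — "the numbers '4', '5', '6'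
correspond to the number of non-cuspidal primes that are either contained in or adjacent to a prime contained in
the support of `a + b`" (p.327).  [cite: MochizukiEtTh2009, Prop 5.3 proof p.326–327 (PDF pp.100–101)] -/
theorem adjacency_criterion (hπ : Surjective π) {p q : ℤ} (hpq : p ≠ q) {c : ℚ} (hc : c ≠ 0) :
    (|p - q| = 1 ↔ ∀ h, IsDegMinimal π (fun i => c * ((stencil p i + stencil q i : ℤ) : ℚ)) h →
        (support h).ncard = 4) ∧
    (|p - q| ≠ 1 ↔ ∀ h, IsDegMinimal π (fun i => c * ((stencil p i + stencil q i : ℤ) : ℚ)) h →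
        (support h).ncard = 5 ∨ (support h).ncard = 6) := by
  have hfin : {i | c * ((stencil p i + stencil q i : ℤ) : ℚ) ≠ 0}.Finite := by
    rw [setOf_pairDegrees_ne_zero hc]; exact stencilSupport_finite p q
  have key : ∀ h, IsDegMinimal π (fun i => c * ((stencil p i + stencil q i : ℤ) : ℚ)) h →
      (support h).ncard = (stencilSupport p q).ncard := fun h hmin => by
    rw [hmin.ncard_support_eq hπ, setOf_pairDegrees_ne_zero hc]
  obtain ⟨h₀, h₀min⟩ := exists_isDegMinimal hπ hfin
  obtain ⟨e4, e56⟩ := ncard_stencilSupport_eq_four_iff hpq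
  constructor
  · constructor
    · intro h1 h hmin
      rw [key h hmin]; exact e4.mpr h1
    · intro H
      exact e4.mp (by rw [← key h₀ h₀min]; exact H h₀ h₀min)
  · constructor
    · intro h1 h hmin
      rw [key h hmin]; exact e56.mpr h1
    · intro H
      exact e56.mp (by rw [← key h₀ h₀min]; exact H h₀ h₀min)

/-! ### The surjection of Proposition 5.3 (iv) (p.326) -/

/-- If `h` is negative at no cusp other than `a` and has negative degree over the component `j`, then `a` lies on
`n_j`. [cite: MochizukiEtTh2009, Prop 5.3 proof p.326 (PDF p.100)] -/
theorem fibre_eq_of_cuspDeg_neg {h : K → ℚ} {a : K} (ha : ∀ k, k ≠ a → 0 ≤ h k) {j : ℤ}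
    (hj : cuspDeg π h j < 0) : π a = j := by
  obtain ⟨k, hk, hk'⟩ := exists_neg_of_cuspDeg_neg π hj
  have : k = a := by
    by_contra hka
    exact absurd hk' (not_lt.mpr (ha k hka))
  rw [← this, hk]

/-- The stencil of `n_j` over `n_j` itself is `−2`. [cite: MochizukiEtTh2009, Prop 5.3 proof p.326 (PDF p.100)] -/
@[simp] theorem stencil_self (j : ℤ) : stencil j j = -2 := by simp [stencil]

/-- The stencil of `n_j` over `n_{j−1}` is `1`. [cite: MochizukiEtTh2009, Prop 5.3 proof p.326 (PDF p.100)] -/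
@[simp] theorem stencil_pred (j : ℤ) : stencil j (j - 1) = 1 := by simp [stencil]

/-- The stencil of `n_j` over `n_{j+1}` is `1`. [cite: MochizukiEtTh2009, Prop 5.3 proof p.326 (PDF p.100)] -/
@[simp] theorem stencil_succ (j : ℤ) : stencil j (j + 1) = 1 := by simp [stencil]

/-- The stencil of `n_j` vanishes off `j−1, j, j+1`. [cite: MochizukiEtTh2009, Prop 5.3 proof p.326 (PDF p.100)] -/
theorem stencil_eq_zero {j i : ℤ} (h1 : i ≠ j - 1) (h2 : i ≠ j) (h3 : i ≠ j + 1) : stencil j i = 0 := by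
  simp [stencil, h1, h2, h3]

/-- The stencil of `n_j` is non-zero exactly over `j−1, j, j+1`. [cite: MochizukiEtTh2009, Prop 5.3 proof p.326 (PDF p.100)] -/
theorem stencil_ne_zero_iff {j i : ℤ} : stencil j i ≠ 0 ↔ i = j - 1 ∨ i = j ∨ i = j + 1 := by
  unfold stencil
  split_ifs <;> omega

/-- The components meeting `n_j` non-trivially are `j−1, j, j+1` (after scaling by `c ≠ 0`).
[cite: MochizukiEtTh2009, Prop 5.3 proof p.326 (PDF p.100)] -/
theorem setOf_singleDegrees_ne_zero {j : ℤ} {c : ℚ} (hc : c ≠ 0) :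
    {i | c * (stencil j i : ℚ) ≠ 0} = {j - 1, j, j + 1} := by
  ext i
  simp only [mem_setOf_eq, ne_eq, mul_eq_zero, hc, false_or, Int.cast_eq_zero, mem_insert_iff,
    mem_singleton_iff]
  exact stencil_ne_zero_iff

/-- **[EtTh] Prop. 5.3 (iv), the description of the surjection `Prime^csp ↠ Prime^ncsp` (abstract form).**  If the
cuspidal divisor `h` (print: `b − a`, `a ∈ 𝔞` primary cuspidal, `b` cuspidal coprime to `a`) is negative at no cusp
other than `a` and is linearly equivalent to `m · n_j` (`m > 0`), i.e. has degrees `c · stencil j` with `c = m > 0` (up to normalisation),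
then the cusp `a` lies on the component `n_j`: "the natural surjection of (iv) is obtained by mapping the prime
determined by `a` to the prime determined by `n`" (p.326).  [cite: MochizukiEtTh2009, Prop 5.3 proof p.326 (PDF p.100)] -/
theorem cspToNcsp_criterion {h : K → ℚ} {a : K} (ha : ∀ k, k ≠ a → 0 ≤ h k) {j : ℤ} {c : ℚ} (hc : 0 < c)
    (hh : HasDegrees π (fun i => c * (stencil j i : ℚ)) h) : π a = j := by
  refine fibre_eq_of_cuspDeg_neg (h := h) ha ?_
  rw [hh j]
  dsimp only
  rw [stencil_self]
  push_cast
  linarith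

/-! ### The incidence sentence of p.326 (`n ∼ n₁ + n₂ − a`, equal multiplicities, half that of `a`) -/

/-- **The structure of a cuspidally minimal `b − a ∼ m · n_j` (abstract form of the p.326 incidence sentence),
competitor-relative form.**  If `h` is negative exactly at the cusp `a` (print: `h = b − a` with `b` cuspidal,
effective and coprime to the primary cuspidal `a`), has the degrees `c · stencil j` and at most three cusps in
its support (degree-minimality tested against the three-cusp competitor of `exists_isDegMinimal_neg_only_at`), `c = m > 0` up to normalisation (print: cuspidally minimal
and linearly equivalent to the primary non-cuspidal `n = m · n_j`), then `a` lies on `n_j` with order `−2c`, and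
`h = c·[k₁] + c·[k₂] − 2c·[a]` for cusps `k₁` on `n_{j−1}` and `k₂` on `n_{j+1}`: "`n` is linearly equivalent to …
`n₁ + n₂ − a`, where `n₁, n₂` … map … to the two non-cuspidal primes that are adjacent … the multiplicities of
`n₁, n₂` are equal to each other as well as to half the multiplicity of `a`" (p.326).
[cite: MochizukiEtTh2009, Prop 5.3 proof p.326 (PDF p.100)] -/
theorem incidence_structure_of_le {h : K → ℚ} {a : K} (ha : ∀ k, k ≠ a → 0 ≤ h k) (ha' : h a < 0)
    {j : ℤ} {c : ℚ} (hc : 0 < c) (hdeg : HasDegrees π (fun i => c * (stencil j i : ℚ)) h)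
    (hle : (support h).encard ≤ 3) :
    π a = j ∧ h a = -2 * c ∧
      ∃ k₁ k₂, π k₁ = j - 1 ∧ π k₂ = j + 1 ∧ h k₁ = c ∧ h k₂ = c ∧ support h = {a, k₁, k₂} := by
  have hπa : π a = j := cspToNcsp_criterion ha hc hdeg
  -- one support point on each of the components `j - 1`, `j + 1`
  have hne1 : cuspDeg π h (j - 1) ≠ 0 := by
    rw [hdeg]; dsimp only; rw [stencil_pred]; push_cast; linarith
  have hne2 : cuspDeg π h (j + 1) ≠ 0 := by
    rw [hdeg]; dsimp only; rw [stencil_succ]; push_cast; linarith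
  obtain ⟨k₁, hk₁, hk₁'⟩ := exists_mem_support_of_cuspDeg_ne_zero π hne1
  obtain ⟨k₂, hk₂, hk₂'⟩ := exists_mem_support_of_cuspDeg_ne_zero π hne2
  have h12 : k₁ ≠ k₂ := fun e => by have := hk₁.symm.trans (e ▸ hk₂); omega
  have ha1 : a ≠ k₁ := fun e => by have := hπa.symm.trans (e ▸ hk₁); omega
  have ha2 : a ≠ k₂ := fun e => by have := hπa.symm.trans (e ▸ hk₂); omega
  -- the support is exactly `{a, k₁, k₂}`: it contains these three and has three elements
  have hsub : ({a, k₁, k₂} : Set K) ⊆ support h := by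
    intro k hk
    simp only [mem_insert_iff, mem_singleton_iff] at hk
    rcases hk with rfl | rfl | rfl
    · exact ha'.ne
    · exact hk₁'
    · exact hk₂'
  have hcard : (support h).encard = 3 := by
    refine le_antisymm hle ?_
    have h3' : ({j - 1, j, j + 1} : Set ℤ).encard = 3 := by
      rw [encard_insert_of_notMem (by simp only [mem_insert_iff, mem_singleton_iff]; omega),
        encard_pair (by omega)]
      rfl
    rw [← h3', ← setOf_singleDegrees_ne_zero hc.ne']
    exact hdeg.encard_le
  have h3 : ({a, k₁, k₂} : Set K).encard = 3 := encard_eq_three.mpr ⟨a, k₁, k₂, ha1, ha2, h12, rfl⟩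
  have hsupp : support h = {a, k₁, k₂} :=
    ((((finite_singleton k₂).insert k₁).insert a).eq_of_subset_of_encard_le hsub (by rw [hcard, h3])).symm
  -- read off the values from the degrees over `j - 1`, `j`, `j + 1`
  have huniq : ∀ (i : ℤ) (k₀ : K), k₀ ∈ ({a, k₁, k₂} : Set K) → π k₀ = i →
      (∀ k ∈ ({a, k₁, k₂} : Set K), π k = i → k = k₀) → cuspDeg π h i = h k₀ := by
    intro i k₀ _ hk₀ H
    refine cuspDeg_eq_of_unique π hk₀ fun k hk hkne => H k ?_ hk
    rw [← mem_support, hsupp] at hkne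
    exact hkne
  have hv1 : h k₁ = c := by
    rw [← huniq (j - 1) k₁ (by simp) hk₁ ?_, hdeg]; · dsimp only; rw [stencil_pred]; push_cast; ring
    intro k hk hki
    simp only [mem_insert_iff, mem_singleton_iff] at hk
    rcases hk with rfl | rfl | rfl
    · omega
    · rfl
    · omega
  have hv2 : h k₂ = c := by
    rw [← huniq (j + 1) k₂ (by simp) hk₂ ?_, hdeg]; · dsimp only; rw [stencil_succ]; push_cast; ring
    intro k hk hki
    simp only [mem_insert_iff, mem_singleton_iff] at hk
    rcases hk with rfl | rfl | rfl
    · omega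
    · omega
    · rfl
  have hva : h a = -2 * c := by
    rw [← huniq j a (by simp) hπa ?_, hdeg]; · dsimp only; rw [stencil_self]; push_cast; ring
    intro k hk hki
    simp only [mem_insert_iff, mem_singleton_iff] at hk
    rcases hk with rfl | rfl | rfl
    · rfl
    · omega
    · omega
  exact ⟨hπa, hva, k₁, k₂, hk₁, hk₂, hv1, hv2, hsupp⟩

/-- **The structure of a cuspidally minimal `b − a ∼ m · n_j`**, degree-minimal form: as
`incidence_structure_of_le`, for `h` degree-minimal among all cuspidal divisors with the degrees `c · stencil j`
("`n` is linearly equivalent to … `n₁ + n₂ − a` … the multiplicities of `n₁, n₂` are equal to each other as well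
as to half the multiplicity of `a`", p.326).  [cite: MochizukiEtTh2009, Prop 5.3 proof p.326 (PDF p.100)] -/
theorem incidence_structure (hπ : Surjective π) {h : K → ℚ} {a : K} (ha : ∀ k, k ≠ a → 0 ≤ h k) (ha' : h a < 0)
    {j : ℤ} {c : ℚ} (hc : 0 < c) (hmin : IsDegMinimal π (fun i => c * (stencil j i : ℚ)) h) :
    π a = j ∧ h a = -2 * c ∧
      ∃ k₁ k₂, π k₁ = j - 1 ∧ π k₂ = j + 1 ∧ h k₁ = c ∧ h k₂ = c ∧ support h = {a, k₁, k₂} := by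
  refine incidence_structure_of_le ha ha' hc hmin.1 (le_of_eq ?_)
  rw [hmin.encard_support_eq hπ, setOf_singleDegrees_ne_zero hc.ne',
    encard_insert_of_notMem (by simp only [mem_insert_iff, mem_singleton_iff]; omega), encard_pair (by omega)]
  rfl

/-- **Existence for (iv) ("witnessed at every cusp").**  Over every cusp `a` (every component carrying a cusp) the
configuration of p.326 exists: for `c ≠ 0` there is a degree-minimal cuspidal divisor for the degrees
`c · stencil (π a)` which is negative exactly at `a` (namely `c·[k₁] + c·[k₂] − 2c·[a]`), with support of three
cusps. [cite: MochizukiEtTh2009, Prop 5.3 proof p.326 (PDF p.100)] -/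
theorem exists_isDegMinimal_neg_only_at (hπ : Surjective π) (a : K) {c : ℚ} (hc : 0 < c) :
    ∃ h, IsDegMinimal π (fun i => c * (stencil (π a) i : ℚ)) h ∧ h a = -2 * c ∧ ∀ k, k ≠ a → 0 ≤ h k := by
  classical
  -- the section through `a` on its own component
  let s : ℤ → K := Function.update (surjInv hπ) (π a) a
  have hs : ∀ i, π (s i) = i := fun i => by
    by_cases hi : i = π a
    · subst hi; simp [s]
    · simp [s, Function.update_of_ne hi, surjInv_eq hπ]
  refine ⟨ofSection π s _, isDegMinimal_ofSection hs ?_, ?_, fun k hk => ?_⟩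
  · rw [setOf_singleDegrees_ne_zero hc.ne']
    exact ((finite_singleton _).insert _).insert _
  · have : s (π a) = a := by simp [s]
    have h1 := ofSection_apply_section hs (fun i => c * (stencil (π a) i : ℚ)) (π a)
    rw [this] at h1
    rw [h1, stencil_self]; push_cast; ring
  · simp only [ofSection]
    split_ifs with hsk
    · have hka : π k ≠ π a := fun e => hk (by rw [← hsk, e]; simp [s])
      rcases eq_or_ne (π k) (π a - 1) with e | e
      · rw [e, stencil_pred]; push_cast; linarith
      rcases eq_or_ne (π k) (π a + 1) with e' | e'
      · rw [e', stencil_succ]; push_cast; linarith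
      rw [stencil_eq_zero e hka e']; simp
    · exact le_rfl

end Literature.AnabelianGeometry.EtaleTheta.ChainDivisors
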